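import Summits.RiemannHypothesis.RiemannHypothesis.Theses.WeilGroundState
import Summits.RiemannHypothesis.RiemannHypothesis.Theorems.WeilGroundStateGroundStatesConvergeToXiStubMellinXi
import Summits.RiemannHypothesis.RiemannHypothesis.Theorems.WeilGroundStateGroundStatesConvergeToXiStubPsiDecay
import Literature.NumberTheory.LFunctions.WeilGroundState

/-!
# Crux `WeilGroundState.GroundStatesConvergeToXi` (stmt-RiemannHypothesis-1527) — negative lemma
# `NotAttained`: the limit `ξ` of the crux is attained at NO finite window

The crux asks for ground states `u_k` at windows `a_k → ∞` and constants `c_k ≠ 0` with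
`c_k · weilMellin u_k → riemannXi` locally uniformly on the open critical strip.  This file proves
(RH-free, sorry-free) that the convergence can only ever be APPROXIMATE: for every integrable
`u : ℝ → ℂ` vanishing a.e. on some right half-line `(a, ∞)` — in particular for every ground
state `IsWeilGroundState a u` of every window, and for every `L²` function supported in a window —
and every constant `c`, the function `c · weilMellin u` differs from `riemannXi` somewhere on the
critical line (hence it is not equal to `ξ` on the open strip, nor on any set accumulating there).

So the natural strengthening "some window already reproduces `ξ` up to a constant" of the crux is
FALSE, the hypothesis `Tendsto a atTop atTop` cannot be traded for a fixed window with exact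
equality, and the `k`-th approximant of ANY witness of the crux is at positive sup-distance from
`ξ` on every compact piece of the critical line (the distance tends to `0` only in the limit).

Proof (Fourier uniqueness against Riemann's kernel).  `Φ(t) = 2Ψ(2t)` has `weilMellin Φ = ξ` on
the critical line (`weilMellin_phi_criticalLine`, landed stub `mellinXi` of the line `Sketch`).
If `c · û = ξ` on the line then `w := c·u·𝟙_{(-∞,a]} − Φ ∈ L¹(ℝ)` has identically vanishing
Fourier transform; Mathlib's Fourier inversion at the continuity point `v = |a| + 1` of `w`
(where `w = −Φ` near `v`) gives `Φ(v) = 0`, contradicting `Ψ > 0` on `[0, ∞)` (each theta term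
`(2y² − 3y)e^{u/4 − y}`, `y = π(n+1)²eᵘ ≥ π > 3/2`, is positive).

References: Titchmarsh 1986 §10.1 (Riemann's kernel); Connes–Consani–Moscovici arXiv:2511.22755
§7 (the conjectural limit formula behind the crux).
-/

set_option linter.dupNamespace false

noncomputable section

open MeasureTheory Complex Filter Set
open scoped Real Topology FourierTransform

namespace Summit.RiemannHypothesis.RiemannHypothesis.Theorems.GroundStatesConvergeToXi.Negative

open Literature.NumberTheory.LFunctions
open Summit.RiemannHypothesis.RiemannHypothesis.Theorems.GroundStatesConvergeToXi

/-! ## Positivity of Riemann's kernel on `[0, ∞)` -/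

/-- Each theta term of `Ψ(x)` is positive for `x ≥ 0`: `y = π(n+1)²eˣ ≥ π > 3/2`, so
`2y² − 3y > 0`. [folklore] -/
theorem thetaTerm_psiPoly_pos {x : ℝ} (hx : 0 ≤ x) (n : ℕ) :
    0 < LagariasMontague.thetaTerm LagariasMontague.psiPoly n x := by
  have hw := LagariasMontague.pi_le_thetaWeight n
  have hwpos := LagariasMontague.thetaWeight_pos n
  have hex : 1 ≤ Real.exp x := Real.one_le_exp hx
  simp only [LagariasMontague.thetaTerm, LagariasMontague.eval_psiPoly]
  refine mul_pos ?_ (Real.exp_pos _)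
  have hy : 3 ≤ LagariasMontague.thetaWeight n * Real.exp x := by
    have h1 : 0 ≤ LagariasMontague.thetaWeight n * (Real.exp x - 1) :=
      mul_nonneg hwpos.le (sub_nonneg.2 hex)
    nlinarith [Real.pi_gt_three]
  nlinarith

/-- `Ψ(x) > 0` for `x ≥ 0` (hence, by evenness, everywhere; only `x ≥ 0` is needed here).
[folklore] -/
theorem Psi_pos_of_nonneg {x : ℝ} (hx : 0 ≤ x) : 0 < LagariasMontague.Psi x :=
  (LagariasMontague.summable_thetaTerm _ x).tsum_pos (fun n => (thetaTerm_psiPoly_pos hx n).le) 0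
    (thetaTerm_psiPoly_pos hx 0)

/-! ## The Mellin transform on the critical line is a Fourier transform -/

/-- On the critical line the Mellin integrand has the modulus of the function:
`‖g(t) e^{iτt}‖ = ‖g(t)‖`. [folklore] -/
theorem norm_mul_cexp_criticalLine (z : ℂ) (τ t : ℝ) :
    ‖z * cexp ((1 / 2 + (τ : ℂ) * I - 1 / 2) * (t : ℂ))‖ = ‖z‖ := by
  have e : (1 / 2 + (τ : ℂ) * I - 1 / 2) * (t : ℂ) = ((τ * t : ℝ) : ℂ) * I := by
    push_cast
    ring
  rw [norm_mul, e, Complex.norm_exp_ofReal_mul_I, mul_one]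

/-- An integrable function has an integrable Mellin integrand on the critical line. [folklore] -/
theorem integrable_mul_cexp_criticalLine {g : ℝ → ℂ} (hg : Integrable g) (τ : ℝ) :
    Integrable fun t : ℝ => g t * cexp ((1 / 2 + (τ : ℂ) * I - 1 / 2) * (t : ℂ)) :=
  hg.norm.mono' (hg.aestronglyMeasurable.mul (Continuous.aestronglyMeasurable (by fun_prop)))
    (ae_of_all _ fun t => (norm_mul_cexp_criticalLine (g t) τ t).le)

/-- Mathlib's Fourier transform of an integrable `g : ℝ → ℂ` in terms of `weilMellin` on the
critical line: `𝓕 g (ξ) = weilMellin g (1/2 − 2πξ i)`. [folklore] -/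
theorem fourier_eq_weilMellin (g : ℝ → ℂ) (ξ : ℝ) :
    𝓕 g ξ = weilMellin g (1 / 2 + ((-2 * π * ξ : ℝ) : ℂ) * I) := by
  rw [Real.fourier_real_eq_integral_exp_smul, weilMellin]
  refine integral_congr_ae (ae_of_all _ fun v => ?_)
  dsimp only
  rw [smul_eq_mul, mul_comm]
  congr 1
  push_cast
  ring

/-! ## The negative lemma -/

/-- **`ξ` is not `c · û` for any integrable `u` vanishing a.e. on a right half-line.**  For such
`u` and any `c : ℂ` there is a point of the critical line where `c · weilMellin u ≠ riemannXi`.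
(Fourier uniqueness against Riemann's kernel `Φ = 2Ψ(2·)`, `Φ̂ = ξ` on the line, `Φ > 0`.)
[folklore] -/
theorem exists_const_mul_weilMellin_ne_riemannXi {u : ℝ → ℂ} (hu : Integrable u) {a : ℝ}
    (hzero : ∀ᵐ t ∂volume, a < t → u t = 0) (c : ℂ) :
    ∃ τ : ℝ, c * weilMellin u (1 / 2 + τ * I) ≠ riemannXi (1 / 2 + τ * I) := by
  by_contra h
  push Not at h
  -- Riemann's kernel and the modified `u`
  set Φ : ℝ → ℂ := fun t => 2 * LagariasMontague.Psic (2 * t) with hΦ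
  set u' : ℝ → ℂ := (Set.Iic a).indicator u with hu'
  have huu' : u =ᵐ[volume] u' := by
    filter_upwards [hzero] with t ht
    by_cases hta : t ≤ a
    · rw [hu', Set.indicator_of_mem (show t ∈ Set.Iic a from hta)]
    · rw [hu', Set.indicator_of_notMem (show t ∉ Set.Iic a from hta)]
      exact ht (lt_of_not_ge hta)
  have hu'int : Integrable u' := hu.congr huu'
  have hΦint : Integrable Φ := by
    have := integrable_phi_mul_cexp stub_psiDecay.2 (1 / 2)
    simpa using this
  set w : ℝ → ℂ := fun t => c * u' t - Φ t with hw
  have hwint : Integrable w := (hu'int.const_mul c).sub hΦint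
  -- `weilMellin w` vanishes on the critical line
  have hmellin : ∀ τ : ℝ, weilMellin w (1 / 2 + τ * I) = 0 := by
    intro τ
    have h1 := integrable_mul_cexp_criticalLine hu'int τ
    have h2 := integrable_mul_cexp_criticalLine hΦint τ
    have h1' : Integrable fun t : ℝ =>
        c * u' t * cexp ((1 / 2 + (τ : ℂ) * I - 1 / 2) * (t : ℂ)) :=
      (h1.const_mul c).congr (ae_of_all _ fun t => by simp only [mul_assoc])
    have hsplit : weilMellin w (1 / 2 + τ * I) =
        c * weilMellin u' (1 / 2 + τ * I) - weilMellin Φ (1 / 2 + τ * I) := by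
      rw [← weilMellin_const_mul]
      unfold weilMellin
      rw [← integral_sub h1' h2]
      refine integral_congr_ae (ae_of_all _ fun t => ?_)
      simp only [hw]
      ring
    have hu'u : weilMellin u' (1 / 2 + τ * I) = weilMellin u (1 / 2 + τ * I) := by
      unfold weilMellin
      refine integral_congr_ae ?_
      filter_upwards [huu'] with t ht
      rw [ht]
    rw [hsplit, hu'u, h τ, hΦ, weilMellin_phi_criticalLine, sub_self]
  -- hence `𝓕 w = 0`
  have hF : 𝓕 w = 0 := by
    funext ξ
    rw [fourier_eq_weilMellin, Pi.zero_apply]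
    exact_mod_cast hmellin (-2 * π * ξ)
  -- Fourier inversion at the continuity point `v = |a| + 1`, where `w = -Φ`
  have hav : a < |a| + 1 := by linarith [le_abs_self a]
  have hwev : w =ᶠ[𝓝 (|a| + 1)] fun t => -Φ t := by
    filter_upwards [Ioi_mem_nhds hav] with t ht
    have hnot : t ∉ Set.Iic a := fun h' => absurd (Set.mem_Iic.1 h') (not_le.2 ht)
    simp only [hw, hu', Set.indicator_of_notMem hnot, mul_zero, zero_sub]
  have hcont : ContinuousAt w (|a| + 1) :=
    (continuous_phi.neg.continuousAt).congr_of_eventuallyEq hwev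
  have hinv := hwint.fourierInv_fourier_eq (by rw [hF]; exact integrable_zero _ _ _) hcont
  rw [hF] at hinv
  have hlhs : (𝓕⁻ (0 : ℝ → ℂ)) (|a| + 1) = 0 := by
    rw [Real.fourierInv_eq']
    simp
  have hwv : w (|a| + 1) = -Φ (|a| + 1) := hwev.self_of_nhds
  rw [hlhs, hwv, hΦ] at hinv
  -- `Φ(|a| + 1) = 2 Ψ(2|a| + 2) > 0`: contradiction
  have hpos : 0 < LagariasMontague.Psi (2 * (|a| + 1)) :=
    Psi_pos_of_nonneg (by positivity)
  have hzeroΨ : (LagariasMontague.Psi (2 * (|a| + 1)) : ℂ) = 0 := by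
    have h2 : (2 : ℂ) * LagariasMontague.Psic (2 * (|a| + 1)) = 0 := by
      simpa using hinv.symm
    simpa [LagariasMontague.Psic] using h2
  exact hpos.ne' (by exact_mod_cast hzeroΨ)

/-- **Strip form.** For `u` integrable and vanishing a.e. on a right half-line, `c · weilMellin u`
is not equal to `riemannXi` on the open critical strip `{0 < Re s < 1}`. [folklore] -/
theorem not_eqOn_strip_const_mul_weilMellin {u : ℝ → ℂ} (hu : Integrable u) {a : ℝ}
    (hzero : ∀ᵐ t ∂volume, a < t → u t = 0) (c : ℂ) :
    ¬ Set.EqOn (fun s => c * weilMellin u s) riemannXi {s : ℂ | 0 < s.re ∧ s.re < 1} := by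
  intro h
  obtain ⟨τ, hτ⟩ := exists_const_mul_weilMellin_ne_riemannXi hu hzero c
  refine hτ (h ?_)
  constructor <;> norm_num

/-- **Ground-state form (the crux's objects).** No ground state of Weil's truncated form at any
window has `c · û = ξ` on the open critical strip: the limit asserted by
`GroundStatesConvergeToXi` is attained at no finite stage, for no normalisation `c`. [folklore] -/
theorem not_eqOn_strip_of_isWeilGroundState {a : ℝ} {u : ℝ → ℂ} (hu : IsWeilGroundState a u)
    (c : ℂ) :
    ¬ Set.EqOn (fun s => c * weilMellin u s) riemannXi {s : ℂ | 0 < s.re ∧ s.re < 1} := by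
  refine not_eqOn_strip_const_mul_weilMellin hu.integrable (a := a) ?_ c
  filter_upwards [hu.ae_eq_zero_of_notMem] with t ht hat
  exact ht fun hmem => absurd hmem.2 (not_le.2 hat)

/-- **The natural strengthening of the crux with EXACT equality at the windows is false**: there
are no windows `a_k`, ground states `u_k` and constants `c_k` with `c_k · weilMellin u_k = ξ` on
the open strip for even one `k` — contrast with the crux, which only asks for convergence.
[folklore] -/
theorem not_exists_groundState_weilMellin_eq_riemannXi :
    ¬ ∃ a : ℝ, ∃ u : ℝ → ℂ, ∃ c : ℂ, IsWeilGroundState a u ∧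
      ∀ s : ℂ, 0 < s.re → s.re < 1 → c * weilMellin u s = riemannXi s := by
  rintro ⟨a, u, c, hu, h⟩
  exact not_eqOn_strip_of_isWeilGroundState hu c fun s hs => h s hs.1 hs.2

end Summit.RiemannHypothesis.RiemannHypothesis.Theorems.GroundStatesConvergeToXi.Negative

end
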